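import Summits.QuantumFields.YangMills.Theorems.BalabanUVNodesN15UnitLayerBgUniformLetters
import Summits.QuantumFields.YangMills.Theorems.BalabanUVNodesN15UnitLayerBgPerturbedCov2156
import Summits.QuantumFields.YangMills.Theorems.BalabanUVNodesN15UnitLayerBgDressing
import Summits.QuantumFields.YangMills.Theorems.BalabanUVNodesN15FullPropagatorC2N15At

/-!
# Route «BalabanUVNodes», cluster K4 «SpineRates» — node N15 = NE2, file U-D (dag-n15-a g16, LOCATED-1): `NE2PlusUnit` BY NAME WITH THE BACKGROUND LIVE —
# the (2.156) unit-lattice covariance `C(C*(Δ_k + P(U))C)⁻¹C*` dressed through the operator layer's OWN background-dressed full `U ≡ 1` propagator, on dag-n15-c's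
# PRIMITIVE-CARRIER family, WINDOW-FREE (threshold in `α₀` ALONE); and `N15At` for that family with TWO of the three layers reading `U`

Cell `pub-ymgap`, seat `pub-ymgap-dag-n15-a` (-a KNIT-BY-NAME seat of node N15; HUMAN RULING D-0062; chair R424 venue), generation 16, file U-D of the LOCATED-1 programme
(INBOX l.22312 ∕ l.22757).  `bears_on: R4∕N15 · K3⁷ SpineGivenEndpointR13SepCoPH (stmt-QuantumFields-20544)`.  Filed `--kind proof --supports stmt-QuantumFields-20544 --as helper` —
COUNT-NEUTRAL.  Two data `def`s (the site kernel `tgCovBg`, the `NE2Objects₁₁` literal `c2BgObjects`), the rest theorems; 0 `sorry`.  Imports BY NAME this seat's U-A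
(`cov2156_rate_torus_add`, `epsCov(_pos)`), U-B (`dressP`, `dressP_isSymm`, `dressP_zero`, `dressP_deltaPol_letters`), U-C∕U-C2∕U-C3 (`zOp`, `unitBondMat`, `boxBondTor`,
`unitBondMat_zero`, `zOp_family_letters`), part 81 (`n15At_fullG_C2`'s operator∕site conjuncts: n15-c FILE 11 `ne2PlusOperator_fullG_C2`, part 78 `tgSiteOn`∕`ne2PlusSite_tgSiteOn`,
part 79 `FGIndexL`); nothing in the tree is modified.

WHAT.
* §1 def `tgCovBg d hL b α β i` — THE U-SEEING UNIT-LATTICE KERNEL on `fgInstanceC2 d hL i`: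
  `(U, y, y′) ↦ C_{P′(U)}^{(L^mL^k)}((ȳ,α),(ȳ′,β)) − C_{P(Ū)}^{(L^k)}((ȳ,α),(ȳ′,β))`, `C_P^{(n)} = C(C*(Δ^{(n)} + P)C)⁻¹C*` (b06's elimination `C`, THE (1.66) matrix `Δ^{(n)}`),
  `P(U) = dressP b Δ^{(n)} (unitBondMat Z^{(n)}(U))` the linearised dressing by the operator layer's OWN dressed propagator (`Z = Q(E₀(U) − G)Q*`), `Ū = avg U` = the pairing's
  block-averaged coarse partner (`pair_avg_eq`: rfl); `tgCovBg_ker`; ★ `tgCovBg_one` (at `U ≡ 1` the kernel IS part 76's genuine (2.156) difference `covDiff`: `zOp_zero`,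
  `unitBondMat_zero`, `dressP_zero`);
* §2 `rpow_pow_eq` (`((L^k)^{−γ} = (L^{−γ})^k`), ★★★ **`ne2PlusUnit_tgCovBg`**: `NE2PlusUnit c₃₅ (fgInstanceC2 d hL ∘ val) (tgCovBg d hL b α β ∘ val) ⊤ dist` on the L-divisible
  sub-index `FGIndexL d` — `d ≥ 1`, odd `L ≥ 3`, `b > 0`, `c₃₅ > 0`, every `α β`: constants `(δ₀, a₀, B₀, θ = L^{−1∕16})` after `d, L, b, c₃₅`; the BACKGROUND IS READ (through
  `P(U)`); the threshold `a₀` is a smallness in `α₀` ALONE (U-A's `epsCov` against U-B's `K(|b|+1)²ζ`); NO weight window, NO Neumann series in a weight — positivity (2.153)∕(2.157);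
  `Reg336` idle (said);
* §3 ★★★ **`n15At_fullG_C2_bg`**: `N15At ⟨FGIndexL d, c₃₅, p, fgInstanceC2 ∘ val, fgFamilyC2 b ∘ val, tgSiteOn a_S …, tgCovBg b α β ∘ val, ⊤, dist⟩` — OPERATOR (FILE 11) and UNIT
  (§2) layers READ `U`; SITE = G1's scalar-sector kernel (U-blind: its dressing is the scalar-sector full-propagator two-grid defect, dag-n15-d∕-e's lane — said);
  def `c2BgObjects`, `ne2OfRecord₁₁_c2BgObjects`, `n15At_c2BgObjects`, `populated_c2BgObjects`; keyed faces `s_N15_of_admits_C2Bg(_family)`, `populated_c2BgObjects_family`,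
  `n15At_c2BgObjects_family`.

HONEST FRAMING.  Count-neutral composition BY NAME; MODEL-LEVEL: the by-parts background species (abelianised first-order coefficients, block-averaged coarse partner),
abelianised `Q`, and the LINEARISED + symmetrised dressing of the (1.66) form (the printed (1.103) motivating it not re-certified); GENUINE: the full `U ≡ 1` Landau-gauge
propagator, THE (1.66) matrix, b06's (2.152)–(2.157) elimination ∕ positivity ∕ decay engine, King's (4.39)–(4.41) mechanism.  NOT [B9] Thm 3.15 at a general (3.35)-regular `U`
(NOT PRINTED as an η-rate; G-B9-09∕10 stand), NOT Node 00's [B9] operator layer of record — **N15 is NOT discharged** (typed 28∕28 · discharged 5∕27 of record unchanged); one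
finite four-torus programme at fixed `ε` — NOT ℝ⁴, NOT infinite volume, NOT OS, NOT a mass gap, NOT Clay.  Restate-immune (no Theses import).
-/

set_option autoImplicit false

noncomputable section

open scoped BigOperators
open Finset

namespace Summit.QuantumFields.YangMills.BalabanUVNodes.N15.UnitLayerBg

open Literature.MathematicalPhysics.QuantumFieldTheory.Balaban1983to89
open Literature.MathematicalPhysics.QuantumFieldTheory.Balaban1983to89.T4Continuum (T4Family ULoop)
open Literature.MathematicalPhysics.QuantumFieldTheory.Balaban1983to89.T4EtaRate (PairedInstance NE2PlusOperator NE2PlusSite NE2PlusUnit EtaRateIneqUnit)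
open Literature.MathematicalPhysics.QuantumFieldTheory.Balaban1983to89.T4EtaRateUnitWitness (covDiff)
open Literature.MathematicalPhysics.QuantumFieldTheory.Balaban1983to89.B5Prop11Plancherel (Tor fine)
open Literature.MathematicalPhysics.QuantumFieldTheory.Balaban1983to89.B6Lemma24Torus (pbox)
open Literature.MathematicalPhysics.QuantumFieldTheory.Balaban1983to89.B6BondEliminationTorus (pdist)
open Literature.MathematicalPhysics.QuantumFieldTheory.Balaban1983to89.B6Cov2156Torus (deltaPol bondReductionT one_le_M)
open Literature.MathematicalPhysics.QuantumFieldTheory.Balaban1983to89.B6LowerBound2153Torus (rep rep_mem_pbox toT_rep)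
open Literature.MathematicalPhysics.QuantumFieldTheory.Balaban1983to89.B6UnitTorusCarrier (unitTorusGeo pdist_rep_rep)
open Literature.MathematicalPhysics.QuantumFieldTheory.Balaban1983to89.B4Sect5Proof (latticeConst latticeConst_nonneg)
open Literature.MathematicalPhysics.QuantumFieldTheory.Balaban1983to89.NE2NodeTorus (ne2PlusOperator_reindex)
open Literature.MathematicalPhysics.QuantumFieldTheory.King1986 (exp_decay_mono)
open Literature.MathematicalPhysics.QuantumFieldTheory.King1986.Torus (tdistT tdistT_nonneg)
open Node00 (NE2Objects₁₁)
open Summit.QuantumFields.BalabanUV.T4Continuum.HistoryFlow (two_le_L)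
open Summit.QuantumFields.YangMills.BalabanUVNodes.N15.TwoGrid (gOp TGIndex tgGeoC)
open Summit.QuantumFields.YangMills.BalabanUVNodes.N15.VectorPiece (kingPrV)
open Summit.QuantumFields.YangMills.BalabanUVNodes.N15.BackgroundLayer (bgPair projO stack unstack avg₁ fgD fgInstanceC2 fgFamilyC2 ne2PlusOperator_fullG_C2 projO_none_comp_stack)
open Summit.QuantumFields.YangMills.BalabanUVNodes.N15.GenuineRecord (FGIndexL fgIndexL_nonempty tgSiteOn ne2PlusSite_tgSiteOn)
open Summit.QuantumFields.YangMills.BalabanUVNodes.N15.AtKeyedHome (s_N15_of_admits neZero_blockFactor)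
open YMDAG.UVSplit (Datum NE2Carriers RateCarriers RateRecordPred N15At S_N15 ne2OfRecord₁₁)

variable {d : ℕ} {L : ℕ} [NeZero L]

/-! ## §1 The U-seeing unit-lattice kernel on the primitive-carrier family -/

section Kernel

/-- THE PERTURBATION OF THE (1.66) MATRIX BY A COEFFICIENT PAIR at fineness `n` on the unit torus `M`: `P^{(n)}(c, a) = dressP b Δ^{(n)} (unitBondMat Z^{(n)}(c, a))` — the
linearised, symmetrised dressing (U-B) by the block-averaged increment of the operator layer's own dressed propagator (U-C). [cite: Balaban1984PropagatorsI, (1.65)–(1.66) p.29,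
(1.101)–(1.103) p.34 (objects, motivating identity)] -/
def bgPert (M : Fin (d + 1) → ℕ) [∀ μ, NeZero (M μ)] (n : ℕ) [NeZero n] (b : ℝ) (c : Tor (fine n M) × Fin (d + 1) → ℝ) (a : Fin (d + 1) → Tor (fine n M) × Fin (d + 1) → ℝ) :
    Matrix (B4.Idx (pbox M) (d + 1)) (B4.Idx (pbox M) (d + 1)) ℝ :=
  dressP b (deltaPol M n) (unitBondMat M (zOp d M n b c a))

/-- THE DRESSED (2.156) COVARIANCE at fineness `n`: `C(C*(Δ^{(n)} + P^{(n)}(c,a))C)⁻¹C*` with b06's elimination matrix of the whole torus. [cite: Balaban1984PropagatorsII, (2.156) p.250 (object)] -/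
def covBg (M : Fin (d + 1) → ℕ) [∀ μ, NeZero (M μ)] (n : ℕ) [NeZero n] (b : ℝ) (c : Tor (fine n M) × Fin (d + 1) → ℝ) (a : Fin (d + 1) → Tor (fine n M) × Fin (d + 1) → ℝ) :
    Matrix (B4.Idx (pbox M) (d + 1)) (B4.Idx (pbox M) (d + 1)) ℝ :=
  (bondReductionT L M (deltaPol M n + bgPert M n b c a)).cov

/-- The pairing's coarse partner IS the block average `avg₁ kingPrV` (FILE 11 `bgPairingC2`, `rfl`). [folklore] -/
theorem pair_avg_eq (hL : Odd L ∧ 1 < L) (i : TGIndex × Fin (d + 1)) (U : (fgInstanceC2 d hL i).Bf.Cfg) :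
    (fgInstanceC2 d hL i).pair.avg U = avg₁ (Fin (d + 1)) (kingPrV L i.1.k i.1.m (TGIndex.Mn d hL i.1)) U := rfl

/-- ★ **THE U-SEEING UNIT-LATTICE η-DIFFERENCE KERNEL** on dag-n15-c's primitive-carrier instance `fgInstanceC2 d hL i` (`i = ((m_T, k, m), ν)`):
`(U, y, y′) ↦ C_{P′(U)}^{(L^mL^k)}((ȳ,α),(ȳ′,β)) − C_{P(Ū)}^{(L^k)}((ȳ,α),(ȳ′,β))` — the fine run's dressed covariance AT `U` minus the coarse run's AT THE PAIRING's COARSE PARTNER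
`Ū = avg U`, read at the unit bonds of directions `α, β` based at the box representatives `ȳ = rep y`. [cite: Balaban1985BackgroundPropagators, Thm 3.15 (3.185)–(3.187) p.432
(shape of `C^{(k)}(Λ)(U)`); Balaban1984PropagatorsII, (2.156) p.250 (object at `U ≡ 1`)] -/
def tgCovBg (d : ℕ) (hL : Odd L ∧ 1 < L) (b : ℝ) (α β : Fin (d + 1)) (i : TGIndex × Fin (d + 1)) : B9.SiteKernel (fgInstanceC2 d hL i).gc (fgInstanceC2 d hL i).Bf :=
  ⟨fun U y y' =>
    covBg (L := L) (TGIndex.Mn d hL i.1) (L ^ i.1.m * L ^ i.1.k) b U.1 U.2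
        (⟨rep (TGIndex.Mn d hL i.1) y, rep_mem_pbox (TGIndex.Mn d hL i.1) y⟩, α) (⟨rep (TGIndex.Mn d hL i.1) y', rep_mem_pbox (TGIndex.Mn d hL i.1) y'⟩, β)
      - covBg (L := L) (TGIndex.Mn d hL i.1) (L ^ i.1.k) b ((fgInstanceC2 d hL i).pair.avg U).1 ((fgInstanceC2 d hL i).pair.avg U).2
        (⟨rep (TGIndex.Mn d hL i.1) y, rep_mem_pbox (TGIndex.Mn d hL i.1) y⟩, α) (⟨rep (TGIndex.Mn d hL i.1) y', rep_mem_pbox (TGIndex.Mn d hL i.1) y'⟩, β)⟩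

/-- Unfolding of `tgCovBg` (coarse partner = `avg₁ kingPrV U`). [folklore] -/
theorem tgCovBg_ker (hL : Odd L ∧ 1 < L) (b : ℝ) (α β : Fin (d + 1)) (i : TGIndex × Fin (d + 1)) (U : (fgInstanceC2 d hL i).Bf.Cfg) (y y' : Tor (TGIndex.Mn d hL i.1)) :
    (tgCovBg d hL b α β i).ker U y y' =
      covBg (L := L) (TGIndex.Mn d hL i.1) (L ^ i.1.m * L ^ i.1.k) b U.1 U.2
          (⟨rep (TGIndex.Mn d hL i.1) y, rep_mem_pbox (TGIndex.Mn d hL i.1) y⟩, α) (⟨rep (TGIndex.Mn d hL i.1) y', rep_mem_pbox (TGIndex.Mn d hL i.1) y'⟩, β)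
        - covBg (L := L) (TGIndex.Mn d hL i.1) (L ^ i.1.k) b (avg₁ (Fin (d + 1)) (kingPrV L i.1.k i.1.m (TGIndex.Mn d hL i.1)) U).1
            (avg₁ (Fin (d + 1)) (kingPrV L i.1.k i.1.m (TGIndex.Mn d hL i.1)) U).2
          (⟨rep (TGIndex.Mn d hL i.1) y, rep_mem_pbox (TGIndex.Mn d hL i.1) y⟩, α) (⟨rep (TGIndex.Mn d hL i.1) y', rep_mem_pbox (TGIndex.Mn d hL i.1) y'⟩, β) := rfl

end Kernel

/-! ## §1b Consistency at `U ≡ 1`: no background, no dressing — the kernel IS the genuine (2.156) difference -/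

section AtOne

variable (M : Fin (d + 1) → ℕ) [∀ μ, NeZero (M μ)] (n : ℕ) [NeZero n] (b : ℝ)

omit [∀ μ, NeZero (M μ)] [NeZero n] [NeZero L] in
/-- The unstacked ZERO coefficients are the zero map. [folklore] -/
theorem unstack_zero : unstack (X := Tor (fine n M) × Fin (d + 1)) (J := Fin (d + 1)) (fun _ => (0 : ℝ)) (fun _ _ => (0 : ℝ)) = 0 := by
  refine LinearMap.ext fun f => funext fun x => ?_
  rw [BackgroundLayer.unstack_apply]
  simp

omit [NeZero L] in
/-- At zero coefficients the dressed propagator IS `G` (`X̂ = (1 − Ĝ·0)⁻¹Ĝ = Ĝ`). [folklore] -/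
theorem e0Op_zero : e0Op d M n b (fun _ => 0) (fun _ _ => 0) = gOp M n b := by
  unfold e0Op bgPair BackgroundLayer.bgPropV
  rw [unstack_zero, LinearMap.comp_zero, map_zero, sub_zero, inv_one, Matrix.one_mul, BackgroundLayer.mulVecLin_toMatrix'_rect, projO_none_comp_stack]

omit [NeZero L] in
/-- … so the increment vanishes, [folklore] -/
theorem wOp_zero : wOp d M n b (fun _ => 0) (fun _ _ => 0) = 0 := by
  unfold wOp; rw [e0Op_zero, sub_self]

omit [NeZero L] in
/-- … the middle factor vanishes, [folklore] -/
theorem zOp_zero : zOp d M n b (fun _ => 0) (fun _ _ => 0) = 0 := by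
  unfold zOp; rw [wOp_zero, LinearMap.zero_comp, LinearMap.comp_zero]

omit [NeZero L] in
/-- … and the perturbation vanishes: `P^{(n)}(0) = 0`. [folklore] -/
theorem bgPert_zero : bgPert M n b (fun _ => 0) (fun _ _ => 0) = 0 := by
  unfold bgPert; rw [zOp_zero, unitBondMat_zero, dressP_zero]

/-- ★ **AT `U ≡ 1` THE U-SEEING KERNEL IS THE GENUINE (2.156) DIFFERENCE**: the primitive carrier's `one` is the zero coefficient pair, whose block average is zero; both
perturbations vanish and `tgCovBg … .ker one y y′ = C^{(L^mL^k)} − C^{(L^k)}` at the bonds — part 76's `covDiff` up to `L^mL^k = L^{k+m}`. [cite: Balaban1984PropagatorsII, (2.156) p.250 (object)] -/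
theorem tgCovBg_one (hL : Odd L ∧ 1 < L) (α β : Fin (d + 1)) (i : TGIndex × Fin (d + 1)) (y y' : Tor (TGIndex.Mn d hL i.1)) :
    (tgCovBg d hL b α β i).ker (fgInstanceC2 d hL i).Bf.one y y' =
      covDiff L (TGIndex.Mn d hL i.1) i.1.k i.1.m (⟨rep (TGIndex.Mn d hL i.1) y, rep_mem_pbox (TGIndex.Mn d hL i.1) y⟩, α)
        (⟨rep (TGIndex.Mn d hL i.1) y', rep_mem_pbox (TGIndex.Mn d hL i.1) y'⟩, β) := by
  have h1 : (fgInstanceC2 d hL i).Bf.one = ((fun _ => 0, fun _ _ => 0) : (Tor (fine (L ^ i.1.m * L ^ i.1.k) (TGIndex.Mn d hL i.1)) × Fin (d + 1) → ℝ) ×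
      (Fin (d + 1) → Tor (fine (L ^ i.1.m * L ^ i.1.k) (TGIndex.Mn d hL i.1)) × Fin (d + 1) → ℝ)) := rfl
  have havg : avg₁ (Fin (d + 1)) (kingPrV L i.1.k i.1.m (TGIndex.Mn d hL i.1))
      ((fun _ => 0, fun _ _ => 0) : (Tor (fine (L ^ i.1.m * L ^ i.1.k) (TGIndex.Mn d hL i.1)) × Fin (d + 1) → ℝ) ×
        (Fin (d + 1) → Tor (fine (L ^ i.1.m * L ^ i.1.k) (TGIndex.Mn d hL i.1)) × Fin (d + 1) → ℝ))
      = ((fun _ => 0, fun _ _ => 0) : (Tor (fine (L ^ i.1.k) (TGIndex.Mn d hL i.1)) × Fin (d + 1) → ℝ) ×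
        (Fin (d + 1) → Tor (fine (L ^ i.1.k) (TGIndex.Mn d hL i.1)) × Fin (d + 1) → ℝ)) :=
    BackgroundLayer.avg₁_zero (Fin (d + 1)) _
  rw [tgCovBg_ker, h1, havg]
  show covBg (L := L) (TGIndex.Mn d hL i.1) (L ^ i.1.m * L ^ i.1.k) b (fun _ => 0) (fun _ _ => 0) _ _
      - covBg (L := L) (TGIndex.Mn d hL i.1) (L ^ i.1.k) b (fun _ => 0) (fun _ _ => 0) _ _ = _
  unfold covBg covDiff
  rw [bgPert_zero, bgPert_zero, add_zero, add_zero, show L ^ i.1.m * L ^ i.1.k = L ^ (i.1.k + i.1.m) by rw [pow_add, mul_comm]]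

end AtOne

/-! ## §2 `NE2PlusUnit` by name with the background LIVE, window-free -/

section UnitLayer

omit [NeZero L] in
/-- `(L^k)^{−γ} = (L^{−γ})^k` (`L ≥ 0`). [folklore] -/
theorem rpow_pow_eq (hL0 : (0 : ℝ) ≤ (L : ℝ)) (k : ℕ) (γ : ℝ) : ((L : ℝ) ^ k) ^ (-γ) = ((L : ℝ) ^ (-γ)) ^ k := by
  rw [← Real.rpow_natCast, ← Real.rpow_mul hL0, mul_comm, Real.rpow_mul hL0, Real.rpow_natCast]

omit [NeZero L] in
/-- On the L-divisible sub-index the periods `M_μ = 2L^{m_T}` are divisible by `L`. [folklore] -/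
theorem dvd_Mn_fg (hL : Odd L ∧ 1 < L) (i : FGIndexL d) (μ : Fin (d + 1)) : L ∣ TGIndex.Mn d hL i.1.1 μ := by
  have hm : i.1.1.mT ≠ 0 := by have := i.2; omega
  show L ∣ 2 * L ^ i.1.1.mT
  exact Dvd.dvd.mul_left (dvd_pow_self L hm) 2

/-- ★★★ **`NE2PlusUnit` — THE NODE's THIRD CONJUNCT BY NAME — WITH THE BACKGROUND LIVE, WINDOW-FREE**, on dag-n15-c's primitive-carrier family over the L-divisible tori of the
family of record: for `d ≥ 1`, odd `L ≥ 3`, `b > 0`, `c₃₅ > 0` and every direction pair `α β`,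
`NE2PlusUnit c₃₅ (fgInstanceC2 d hL ∘ val) (tgCovBg d hL b α β ∘ val) ⊤ dist` — constants `(δ₀, a₀, B₀, θ = L^{−1∕16})` after `d, L, b, c₃₅`.  The kernel READS `U`: the fine
run's (2.156) covariance is dressed by `P′(U)` and the coarse run's by `P(Ū)`, `Ū` the pairing's block average; the threshold `a₀` is a smallness in `α₀` ALONE (U-A's `epsCov`
against U-B's amplitude `K(|b|+1)²ζ` and U-C2's `a₁`); the inverse exists by the PRINTED positivity (2.153)∕(2.157) — NO weight window, NO Neumann series in a weight; the
(3.36) hypothesis is idle (said).  Chain: U-C2 `zOp_family_letters` → U-B `dressP_deltaPol_letters` → U-A `cov2156_rate_torus_add`. [cite: Balaban1985BackgroundPropagators,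
Thm 3.15 (3.185)–(3.187) p.432 (quantifier template, shape); Balaban1984PropagatorsII, (2.153)–(2.157) pp.249–250 (positivity, object); King1986, Lemma 4.5 (4.38)–(4.41) pp.674–675 (shape, mechanism)] -/
theorem ne2PlusUnit_tgCovBg (hd : 1 ≤ d) (hLodd : Odd L) (hL2 : 2 ≤ L) (hL : Odd L ∧ 1 < L) {b : ℝ} (hb : 0 < b) {c35 : ℝ} (hc35 : 0 < c35) (α β : Fin (d + 1)) :
    NE2PlusUnit c35 (fun i : FGIndexL d => fgInstanceC2 d hL i.1) (fun i => tgCovBg d hL b α β i.1) (fun _ _ => True) (fun i => (tgGeoC d hL i.1.1).dist) := by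
  have hL1 : 1 ≤ L := by omega
  have hL1r : (1 : ℝ) ≤ (L : ℝ) := by exact_mod_cast hL1
  have hL0r : (0 : ℝ) ≤ (L : ℝ) := by positivity
  obtain ⟨δZ, ζ, τ, a₁, hδZ, hζ, hτ, ha₁, HZ⟩ := zOp_family_letters (d := d) hLodd hL2 hL hb c35 hc35
  obtain ⟨K, δ', hK, hδ', HP⟩ := dressP_deltaPol_letters (d + 1) (by omega) hδZ
  obtain ⟨C', δ'', hC', hδ'', HC⟩ := cov2156_rate_torus_add (d + 1) (by omega) hL1 (δP := δ') hδ'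
  have hε₀ := epsCov_pos (d := d + 1) (L := L) (by omega) hL1 hδ'
  have hKb : 0 < K * (|b| + 1) ^ 2 * ζ := by positivity
  -- the threshold and the constants
  refine ⟨δ'', min a₁ (epsCov (d + 1) L δ' / (K * (|b| + 1) ^ 2 * ζ)), C' * (1 + K * (|b| + 1) ^ 2 * (τ + ζ * min a₁ (epsCov (d + 1) L δ' / (K * (|b| + 1) ^ 2 * ζ)))) + 1,
    (L : ℝ) ^ (-(1 / 16 : ℝ)), hδ'', lt_min ha₁ (div_pos hε₀ hKb), by positivity, Real.rpow_pos_of_pos (by positivity) _,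
    Real.rpow_lt_one_of_one_lt_of_neg (by exact_mod_cast hL2) (by norm_num), fun i α₀ hα₀ hMα U hreg _ y y' _ _ => ?_⟩
  -- the index data
  have ha₀0 : 0 ≤ min a₁ (epsCov (d + 1) L δ' / (K * (|b| + 1) ^ 2 * ζ)) := (lt_min ha₁ (div_pos hε₀ hKb)).le
  have hM1 : (fgInstanceC2 d hL i.1).gf.M = 1 := rfl
  rw [hM1, one_mul] at hMα
  have hαa₁ : α₀ ≤ a₁ := hMα.trans (min_le_left _ _)
  have hαε : K * (|b| + 1) ^ 2 * (ζ * α₀) ≤ epsCov (d + 1) L δ' := by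
    have h1 : α₀ ≤ epsCov (d + 1) L δ' / (K * (|b| + 1) ^ 2 * ζ) := hMα.trans (min_le_right _ _)
    have h2 := mul_le_mul_of_nonneg_left h1 hKb.le
    rw [mul_div_cancel₀ _ hKb.ne'] at h2
    calc K * (|b| + 1) ^ 2 * (ζ * α₀) = K * (|b| + 1) ^ 2 * ζ * α₀ := by ring
      _ ≤ epsCov (d + 1) L δ' := h2
  have hLk : 1 ≤ L ^ i.1.1.k := Nat.one_le_pow _ _ hL1
  have hLm : 1 ≤ L ^ i.1.1.m := Nat.one_le_pow _ _ hL1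
  have hLkr : (0 : ℝ) < (L : ℝ) ^ i.1.1.k := by positivity
  have ht0 : 0 ≤ ((L : ℝ) ^ i.1.1.k) ^ (-(1 / 16 : ℝ)) := Real.rpow_nonneg hLkr.le _
  have htinv : (((L ^ i.1.1.k : ℕ) : ℝ))⁻¹ ≤ ((L : ℝ) ^ i.1.1.k) ^ (-(1 / 16 : ℝ)) := by
    have h := inv_pow_le_sixteenth (L := L) hL1r i.1.1.k
    have e : (((L ^ i.1.1.k : ℕ) : ℝ)) = (L : ℝ) ^ i.1.1.k := by push_cast; ring
    rwa [e]
  have hn0 : 0 ≤ (((L ^ i.1.1.k : ℕ) : ℝ))⁻¹ := by positivity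
  -- U-C2: the middle factor's letters
  obtain ⟨hZ1, hZ2, hZ3⟩ := HZ i.1 α₀ hα₀ hαa₁ U hreg
  -- U-B: the perturbation letters
  obtain ⟨hP1, hP2, hP12⟩ := HP (TGIndex.Mn d hL i.1.1) (L ^ i.1.1.k) (L ^ i.1.1.m * L ^ i.1.1.k) (L ^ i.1.1.m) hLk hLm rfl b
    (unitBondMat (TGIndex.Mn d hL i.1.1) (zOp d (TGIndex.Mn d hL i.1.1) (L ^ i.1.1.k) b
      (avg₁ (Fin (d + 1)) (kingPrV L i.1.1.k i.1.1.m (TGIndex.Mn d hL i.1.1)) U).1 (avg₁ (Fin (d + 1)) (kingPrV L i.1.1.k i.1.1.m (TGIndex.Mn d hL i.1.1)) U).2))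
    (unitBondMat (TGIndex.Mn d hL i.1.1) (zOp d (TGIndex.Mn d hL i.1.1) (L ^ i.1.1.m * L ^ i.1.1.k) b U.1 U.2))
    (ζ * α₀) (τ * ((L : ℝ) ^ i.1.1.k) ^ (-(1 / 16 : ℝ))) (by positivity) (by positivity) hZ1 hZ2 hZ3
  -- U-A: the perturbed covariance rate
  have hcov := HC (TGIndex.Mn d hL i.1.1) (dvd_Mn_fg (d := d) hL i) (L ^ i.1.1.k) (L ^ i.1.1.m * L ^ i.1.1.k) (L ^ i.1.1.m) hLk hLm rfl
    (bgPert (TGIndex.Mn d hL i.1.1) (L ^ i.1.1.k) b (avg₁ (Fin (d + 1)) (kingPrV L i.1.1.k i.1.1.m (TGIndex.Mn d hL i.1.1)) U).1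
      (avg₁ (Fin (d + 1)) (kingPrV L i.1.1.k i.1.1.m (TGIndex.Mn d hL i.1.1)) U).2)
    (bgPert (TGIndex.Mn d hL i.1.1) (L ^ i.1.1.m * L ^ i.1.1.k) b U.1 U.2) (dressP_isSymm _ _ _) (dressP_isSymm _ _ _)
    (K * (|b| + 1) ^ 2 * (ζ * α₀)) (K * (|b| + 1) ^ 2 * (τ * ((L : ℝ) ^ i.1.1.k) ^ (-(1 / 16 : ℝ)) + ζ * α₀ * (((L ^ i.1.1.k : ℕ) : ℝ))⁻¹))
    (by positivity) hαε (by positivity) hP1 hP2 hP12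
    (⟨rep (TGIndex.Mn d hL i.1.1) y, rep_mem_pbox (TGIndex.Mn d hL i.1.1) y⟩, α) (⟨rep (TGIndex.Mn d hL i.1.1) y', rep_mem_pbox (TGIndex.Mn d hL i.1.1) y'⟩, β)
  have hdist : pdist (TGIndex.Mn d hL i.1.1) (one_le_M (TGIndex.Mn d hL i.1.1)) (rep (TGIndex.Mn d hL i.1.1) y) (rep (TGIndex.Mn d hL i.1.1) y')
      = tdistT (TGIndex.Mn d hL i.1.1) y y' := pdist_rep_rep _ _ y y'
  rw [tgCovBg_ker]
  show |covBg (L := L) (TGIndex.Mn d hL i.1.1) (L ^ i.1.1.m * L ^ i.1.1.k) b U.1 U.2 _ _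
      - covBg (L := L) (TGIndex.Mn d hL i.1.1) (L ^ i.1.1.k) b _ _ _ _|
    ≤ (C' * (1 + K * (|b| + 1) ^ 2 * (τ + ζ * min a₁ (epsCov (d + 1) L δ' / (K * (|b| + 1) ^ 2 * ζ)))) + 1) * Real.exp (-(δ'' * tdistT (TGIndex.Mn d hL i.1.1) y y')) *
      ((L : ℝ) ^ (-(1 / 16 : ℝ))) ^ i.1.1.k
  unfold covBg
  refine hcov.trans ?_
  rw [← rpow_pow_eq hL0r, ← hdist]
  have hE := Real.exp_nonneg (-(δ'' * pdist (TGIndex.Mn d hL i.1.1) (one_le_M (TGIndex.Mn d hL i.1.1)) (rep (TGIndex.Mn d hL i.1.1) y) (rep (TGIndex.Mn d hL i.1.1) y')))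
  -- the amplitude against t = (L^k)^{−1/16}
  have hamp : C' * ((((L ^ i.1.1.k : ℕ) : ℝ))⁻¹ + K * (|b| + 1) ^ 2 * (τ * ((L : ℝ) ^ i.1.1.k) ^ (-(1 / 16 : ℝ)) + ζ * α₀ * (((L ^ i.1.1.k : ℕ) : ℝ))⁻¹))
      ≤ (C' * (1 + K * (|b| + 1) ^ 2 * (τ + ζ * min a₁ (epsCov (d + 1) L δ' / (K * (|b| + 1) ^ 2 * ζ)))) + 1) * ((L : ℝ) ^ i.1.1.k) ^ (-(1 / 16 : ℝ)) := by
    have h1 : ζ * α₀ * (((L ^ i.1.1.k : ℕ) : ℝ))⁻¹ ≤ ζ * min a₁ (epsCov (d + 1) L δ' / (K * (|b| + 1) ^ 2 * ζ)) * ((L : ℝ) ^ i.1.1.k) ^ (-(1 / 16 : ℝ)) :=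
      mul_le_mul (mul_le_mul_of_nonneg_left hMα hζ.le) htinv hn0 (by positivity)
    have h2 : K * (|b| + 1) ^ 2 * (τ * ((L : ℝ) ^ i.1.1.k) ^ (-(1 / 16 : ℝ)) + ζ * α₀ * (((L ^ i.1.1.k : ℕ) : ℝ))⁻¹)
        ≤ K * (|b| + 1) ^ 2 * (τ + ζ * min a₁ (epsCov (d + 1) L δ' / (K * (|b| + 1) ^ 2 * ζ))) * ((L : ℝ) ^ i.1.1.k) ^ (-(1 / 16 : ℝ)) := by
      have := add_le_add (le_refl (τ * ((L : ℝ) ^ i.1.1.k) ^ (-(1 / 16 : ℝ)))) h1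
      calc K * (|b| + 1) ^ 2 * (τ * ((L : ℝ) ^ i.1.1.k) ^ (-(1 / 16 : ℝ)) + ζ * α₀ * (((L ^ i.1.1.k : ℕ) : ℝ))⁻¹)
          ≤ K * (|b| + 1) ^ 2 * (τ * ((L : ℝ) ^ i.1.1.k) ^ (-(1 / 16 : ℝ)) + ζ * min a₁ (epsCov (d + 1) L δ' / (K * (|b| + 1) ^ 2 * ζ)) * ((L : ℝ) ^ i.1.1.k) ^ (-(1 / 16 : ℝ))) :=
            mul_le_mul_of_nonneg_left this (by positivity)
        _ = _ := by ring
    calc C' * ((((L ^ i.1.1.k : ℕ) : ℝ))⁻¹ + K * (|b| + 1) ^ 2 * (τ * ((L : ℝ) ^ i.1.1.k) ^ (-(1 / 16 : ℝ)) + ζ * α₀ * (((L ^ i.1.1.k : ℕ) : ℝ))⁻¹))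
        ≤ C' * (((L : ℝ) ^ i.1.1.k) ^ (-(1 / 16 : ℝ)) + K * (|b| + 1) ^ 2 * (τ + ζ * min a₁ (epsCov (d + 1) L δ' / (K * (|b| + 1) ^ 2 * ζ))) * ((L : ℝ) ^ i.1.1.k) ^ (-(1 / 16 : ℝ))) :=
          mul_le_mul_of_nonneg_left (add_le_add htinv h2) hC'.le
      _ = (C' * (1 + K * (|b| + 1) ^ 2 * (τ + ζ * min a₁ (epsCov (d + 1) L δ' / (K * (|b| + 1) ^ 2 * ζ))))) * ((L : ℝ) ^ i.1.1.k) ^ (-(1 / 16 : ℝ)) := by ring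
      _ ≤ _ := mul_le_mul_of_nonneg_right (by linarith) ht0
  calc C' * ((((L ^ i.1.1.k : ℕ) : ℝ))⁻¹ + K * (|b| + 1) ^ 2 * (τ * ((L : ℝ) ^ i.1.1.k) ^ (-(1 / 16 : ℝ)) + ζ * α₀ * (((L ^ i.1.1.k : ℕ) : ℝ))⁻¹)) *
        Real.exp (-(δ'' * pdist (TGIndex.Mn d hL i.1.1) (one_le_M (TGIndex.Mn d hL i.1.1)) (rep (TGIndex.Mn d hL i.1.1) y) (rep (TGIndex.Mn d hL i.1.1) y')))
      ≤ (C' * (1 + K * (|b| + 1) ^ 2 * (τ + ζ * min a₁ (epsCov (d + 1) L δ' / (K * (|b| + 1) ^ 2 * ζ)))) + 1) * ((L : ℝ) ^ i.1.1.k) ^ (-(1 / 16 : ℝ)) *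
        Real.exp (-(δ'' * pdist (TGIndex.Mn d hL i.1.1) (one_le_M (TGIndex.Mn d hL i.1.1)) (rep (TGIndex.Mn d hL i.1.1) y) (rep (TGIndex.Mn d hL i.1.1) y'))) :=
        mul_le_mul_of_nonneg_right hamp hE
    _ = _ := by ring

end UnitLayer

/-! ## §3 `N15At` for the primitive-carrier family with TWO U-seeing layers; the `NE2Objects₁₁` literal; keyed faces -/

section Record

/-- ★★★ **`N15At` — ALL THREE CONJUNCTS BY NAME, NO DISPLAYED BINDER, TWO OF THEM READING THE BACKGROUND.**  For `d ≥ 1`, odd `L ≥ 3`, `b, a_S > 0`, `c₃₅ > 0`, directions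
`α β`, every `p`: `N15At ⟨FGIndexL d, c₃₅, p, fgInstanceC2 ∘ val, fgFamilyC2 b ∘ val, tgSiteOn a_S …, tgCovBg b α β ∘ val, ⊤, dist⟩` — OPERATOR = n15-c FILE 11
`ne2PlusOperator_fullG_C2` (background LIVE over the primitive letters), UNIT = §2 `ne2PlusUnit_tgCovBg` (background LIVE through the dressed (1.66) form), SITE = dag-n15-c G1's
genuine `U ≡ 1` scalar-sector kernel `(Q′G′²Q′*)⁻¹` (U-BLIND — its honest dressing is the scalar-sector full-propagator two-grid defect, dag-n15-d∕-e's King-model lane; said).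
[bookkeeping] -/
theorem n15At_fullG_C2_bg (hd : 1 ≤ d) (hLodd : Odd L) (hL2 : 2 ≤ L) (hL : Odd L ∧ 1 < L) {b aS : ℝ} (hb : 0 < b) (haS : 0 < aS) {c35 : ℝ} (hc35 : 0 < c35)
    (α β : Fin (d + 1)) (p : ℝ) :
    N15At { I := FGIndexL d, c35 := c35, p := p, pi := fun i => fgInstanceC2 d hL i.1,
            Kop := fun i => fgFamilyC2 d hL b i.1,
            Ksite := tgSiteOn d hL aS (fun i : FGIndexL d => i.1.1) (fun i => (fgInstanceC2 d hL i.1).Bf),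
            Kunit := fun i => tgCovBg d hL b α β i.1,
            inΛ := fun _ _ => True, unitDist := fun i => (tgGeoC d hL i.1.1).dist } :=
  ⟨ne2PlusOperator_reindex (Subtype.val : FGIndexL d → TGIndex × Fin (d + 1)) (ne2PlusOperator_fullG_C2 d hd hLodd hL2 hL hb c35 hc35),
   ne2PlusSite_tgSiteOn (d := d) (fun i : FGIndexL d => i.1.1) (fun i => (fgInstanceC2 d hL i.1).gf) (fun i => (fgInstanceC2 d hL i.1).Bc)
     (fun i => (fgInstanceC2 d hL i.1).Bf) hLodd hL2 hL haS (fun i => (fgInstanceC2 d hL i.1).pair) 4 p c35,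
   ne2PlusUnit_tgCovBg (d := d) hd hLodd hL2 hL hb hc35 α β⟩

/-- **N15's NE2 OBJECTS OF THE PRIMITIVE-CARRIER FAMILY WITH THE U-SEEING UNIT LAYER** (RR-1's layer-A container): as part 81's `c2Objects` with the unit kernel replaced by
`tgCovBg b α β` (the dressed (2.156) covariance difference, background LIVE). [bookkeeping] -/
def c2BgObjects (d : ℕ) (hL : Odd L ∧ 1 < L) (b aS : ℝ) (α β : Fin (d + 1)) (c35 p : ℝ) : NE2Objects₁₁ where
  I := FGIndexL d
  c35 := c35
  p := p
  pi := fun i => fgInstanceC2 d hL i.1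
  Kop := fun i => fgFamilyC2 d hL b i.1
  Ksite := tgSiteOn d hL aS (fun i : FGIndexL d => i.1.1) (fun i => (fgInstanceC2 d hL i.1).Bf)
  Kunit := fun i => tgCovBg d hL b α β i.1
  inΛ := fun _ _ => True
  unitDist := fun i => (tgGeoC d hL i.1.1).dist

/-- The home's NE2 bundle of the objects IS §3's record (`rfl`). [bookkeeping] -/
theorem ne2OfRecord₁₁_c2BgObjects (hL : Odd L ∧ 1 < L) (b aS : ℝ) (α β : Fin (d + 1)) (c35 p : ℝ) :
    ne2OfRecord₁₁ (c2BgObjects d hL b aS α β c35 p) =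
      { I := FGIndexL d, c35 := c35, p := p, pi := fun i => fgInstanceC2 d hL i.1,
        Kop := fun i => fgFamilyC2 d hL b i.1,
        Ksite := tgSiteOn d hL aS (fun i : FGIndexL d => i.1.1) (fun i => (fgInstanceC2 d hL i.1).Bf),
        Kunit := fun i => tgCovBg d hL b α β i.1,
        inΛ := fun _ _ => True, unitDist := fun i => (tgGeoC d hL i.1.1).dist } := rfl

/-- ★★★ **`N15At` AT THE OBJECTS' BUNDLE** (`c₃₅ > 0`). [bookkeeping] -/
theorem n15At_c2BgObjects (hd : 1 ≤ d) (hLodd : Odd L) (hL2 : 2 ≤ L) (hL : Odd L ∧ 1 < L) {b aS : ℝ} (hb : 0 < b) (haS : 0 < aS) {c35 : ℝ} (hc35 : 0 < c35)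
    (α β : Fin (d + 1)) (p : ℝ) : N15At (ne2OfRecord₁₁ (c2BgObjects d hL b aS α β c35 p)) :=
  n15At_fullG_C2_bg (d := d) hd hLodd hL2 hL hb haS hc35 α β p

/-- **RR-1's DISPLAY HOLDS AT THE LITERAL**: `Populated`. [bookkeeping] -/
theorem populated_c2BgObjects (hL : Odd L ∧ 1 < L) (b aS : ℝ) (α β : Fin (d + 1)) (c35 p : ℝ) :
    (c2BgObjects d hL b aS α β c35 p).Populated :=
  (NE2Objects₁₁.populated_iff _).2 fgIndexL_nonempty

variable {N : ℕ} [NeZero N] {key : (F : T4Family) → Datum F N → Prop}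

/-- ★★ **THE READING CLOSES THE STUB AT ANY KEYED HOME** (part 30's interface; `d ≥ 1`, odd `L ≥ 3`, `b, a_S > 0`, `c₃₅ > 0`). [bookkeeping] -/
theorem s_N15_of_admits_C2Bg (hd : 1 ≤ d) (hLodd : Odd L) (hL2 : 2 ≤ L) (hL : Odd L ∧ 1 < L) {b aS : ℝ} (hb : 0 < b) (haS : 0 < aS) {c35 : ℝ} (hc35 : 0 < c35)
    (α β : Fin (d + 1)) (p : ℝ)
    (ne2At : ∀ {F : T4Family} {D : Datum F N}, key F D → (ℕ → ℝ) → List (ULoop F) → ℕ → NE2Objects₁₁) (RRec : RateRecordPred N)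
    (hadm : ∀ (F : T4Family) (D : Datum F N) (g₀ : ℕ → ℝ) (os : List (ULoop F)) (R : RateCarriers N), RRec F D g₀ os R →
      ∃ (h : key F D) (k : ℕ), R.ne2 = ne2OfRecord₁₁ (ne2At h g₀ os k))
    (h : ∀ (F : T4Family) (D : Datum F N) (h : key F D) (g₀ : ℕ → ℝ) (os : List (ULoop F)) (k : ℕ), ne2At h g₀ os k = c2BgObjects d hL b aS α β c35 p) :
    S_N15 RRec := by
  refine s_N15_of_admits ne2At RRec hadm fun F D hk g₀ os k => ?_
  rw [h F D hk g₀ os k]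
  exact n15At_c2BgObjects (d := d) hd hLodd hL2 hL hb haS hc35 α β p

/-- ★★ **THE FAMILY-KEYED READING CLOSES THE STUB AT ANY KEYED HOME** (`d + 1 = 4`; `fgInstanceC2 3 F.hL`, block factor `F.L`). [bookkeeping] -/
theorem s_N15_of_admits_C2Bg_family {b aS : ℝ} (hb : 0 < b) (haS : 0 < aS) {c35 : ℝ} (hc35 : 0 < c35) (α β : Fin 4) (p : ℝ)
    (ne2At : ∀ {F : T4Family} {D : Datum F N}, key F D → (ℕ → ℝ) → List (ULoop F) → ℕ → NE2Objects₁₁) (RRec : RateRecordPred N)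
    (hadm : ∀ (F : T4Family) (D : Datum F N) (g₀ : ℕ → ℝ) (os : List (ULoop F)) (R : RateCarriers N), RRec F D g₀ os R →
      ∃ (h : key F D) (k : ℕ), R.ne2 = ne2OfRecord₁₁ (ne2At h g₀ os k))
    (h : ∀ (F : T4Family) (D : Datum F N) (h : key F D) (g₀ : ℕ → ℝ) (os : List (ULoop F)) (k : ℕ),
      ne2At h g₀ os k = haveI := neZero_blockFactor F; c2BgObjects 3 F.hL b aS α β c35 p) :
    S_N15 RRec := by
  refine s_N15_of_admits ne2At RRec hadm fun F D hk g₀ os k => ?_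
  rw [h F D hk g₀ os k]
  haveI := neZero_blockFactor F
  exact n15At_c2BgObjects (d := 3) (by norm_num) F.hL.1 (two_le_L F) F.hL hb haS hc35 α β p

/-- **RR-1's DISPLAY AT THE FAMILY-KEYED LITERAL**. [bookkeeping] -/
theorem populated_c2BgObjects_family (F : T4Family) (b aS : ℝ) (α β : Fin 4) (c35 p : ℝ) :
    (haveI := neZero_blockFactor F; c2BgObjects 3 F.hL b aS α β c35 p).Populated := by
  haveI := neZero_blockFactor F
  exact populated_c2BgObjects F.hL b aS α β c35 p

/-- `N15At` at the family-keyed literal (`(3, F.hL)`; `c₃₅ > 0`). [bookkeeping] -/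
theorem n15At_c2BgObjects_family {b aS : ℝ} (hb : 0 < b) (haS : 0 < aS) {c35 : ℝ} (hc35 : 0 < c35) (α β : Fin 4) (p : ℝ) (F : T4Family) :
    N15At (ne2OfRecord₁₁ (haveI := neZero_blockFactor F; c2BgObjects 3 F.hL b aS α β c35 p)) := by
  haveI := neZero_blockFactor F
  exact n15At_c2BgObjects (d := 3) (by norm_num) F.hL.1 (two_le_L F) F.hL hb haS hc35 α β p

end Record


end Summit.QuantumFields.YangMills.BalabanUVNodes.N15.UnitLayerBg

end
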